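import Literature.Computability.AlgebraicComplexity.NestFreeMatchingPoly
import HarnessLib

/-!
# Route FifoMatching — crux `NNLowDegreeCofactorHard` (stmt-ValiantsHypothesis-22993), line
# `freed_vertices`: carving combinatorics for stub S2 `stub_carveInterval`

Registered line `Cruxes/NNLowDegreeCofactorHard/Lines/freed_vertices.lean`.  Stub S2 carves an
interval `I = [a, a + 2m) ⊆ [2n]` (even offset `a`, disjoint from the freed vertex set `R`) out
of the nest-free matching polynomial.  This file is the matching combinatorics behind it (no
polynomials yet):

* `Carve.partner` — the consecutive-pairs matching `i ↦ i xor 1` of `Fin (2k)`; it is a nest-free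
  perfect matching (`partner_mem_nestFreeMatchings`).
* `Carve.Carving n` — carving data `(a, m)` with `a + 2m ≤ 2n`, `0 < m`, `a` even; the interval
  `I`, the order embedding `up : Fin (2m) → Fin (2n)`, `j ↦ a + j`, and its retraction `dn`.
* `restrict` / `extend` — a nest-free perfect matching of `[2n]` mapping `I` into `I` restricts
  to one of `I ≅ [2m]` (`restrict_mem_nestFreeMatchings`); a nest-free perfect matching of `[2m]`
  extends, by consecutive pairs outside `I`, to one of `[2n]` that never crosses the boundary of
  `I` (`extend_mem_nestFreeMatchings`, `extend_mem_I_iff`, `restrict_extend`).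
* `intOp` — the arcs of `M` inside `I` (as openers, in `[2m]`-coordinates): at most `m` of them
  (`card_intOp_le`), and exactly `m` only if `M` maps `I` into `I`
  (`forall_mem_I_of_card_intOp`).

Honest framing: bookkeeping for one registered stub of one line; the crux, the line and
`VP ≠ VNP` are untouched (NOT proved).  No named facts. [folklore]
-/

noncomputable section

-- Sub = Summit single-conjunct layout: the duplicated namespace component is mandated by the tree.
set_option linter.dupNamespace false

namespace Summit.ValiantsHypothesis.ValiantsHypothesis.Theorems.FifoMatching.NNLowDegreeCofactorHard.FreedVertices.Carve

open Finset Literature.Computability.AlgebraicComplexity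

/-! ### The consecutive-pairs matching -/

/-- The consecutive-pairs matching of `Fin (2k)`: `2t ↦ 2t+1`, `2t+1 ↦ 2t`. [folklore] -/
def partner {k : ℕ} (i : Fin (2 * k)) : Fin (2 * k) :=
  ⟨if (i : ℕ) % 2 = 0 then (i : ℕ) + 1 else (i : ℕ) - 1, by
    have := i.2
    split_ifs <;> omega⟩

/-- Value of `partner`. [folklore] -/
theorem partner_val {k : ℕ} (i : Fin (2 * k)) :
    ((partner i : Fin (2 * k)) : ℕ) = if (i : ℕ) % 2 = 0 then (i : ℕ) + 1 else (i : ℕ) - 1 :=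
  rfl

/-- `partner` is an involution. [folklore] -/
theorem partner_partner {k : ℕ} (i : Fin (2 * k)) : partner (partner i) = i := by
  apply Fin.ext
  rw [partner_val, partner_val]
  split_ifs <;> omega

/-- `partner` has no fixed point. [folklore] -/
theorem partner_ne {k : ℕ} (i : Fin (2 * k)) : partner i ≠ i := by
  intro h
  have h' := congrArg Fin.val h
  rw [partner_val] at h'
  split_ifs at h' <;> omega

/-- The consecutive-pairs matching is a nest-free perfect matching of `Fin (2k)`. [folklore] -/
theorem partner_mem_nestFreeMatchings (k : ℕ) :
    (fun i : Fin (2 * k) => partner i) ∈ nestFreeMatchings (2 * k) := by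
  refine mem_nestFreeMatchings.2
    ⟨mem_perfectMatchings.2 ⟨fun i => partner_partner i, fun i => partner_ne i⟩, ?_⟩
  intro i j hij hj hji
  rw [Fin.lt_def] at hij hj hji
  rw [partner_val, partner_val] at hji
  rw [partner_val] at hj
  split_ifs at hj hji <;> omega

/-! ### Carving data -/

/-- Carving data for `[2n]`: an interval `I = [a, a + 2m)` of even offset `a` and positive
half-length `m` inside `[2n]`. [folklore] -/
structure Carving (n : ℕ) where
  /-- The (even) offset of the interval. -/
  a : ℕ
  /-- Half the length of the interval. -/
  m : ℕ
  /-- The interval fits: `a + 2m ≤ 2n`. -/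
  le : a + 2 * m ≤ 2 * n
  /-- The interval is nonempty. -/
  pos : 0 < m
  /-- The offset is even. -/
  even : a % 2 = 0

namespace Carving

variable {n : ℕ} (C : Carving n)

/-- The interval `I = [a, a + 2m)` as a finset of `Fin (2n)`. [folklore] -/
def I : Finset (Fin (2 * n)) :=
  univ.filter fun i => C.a ≤ (i : ℕ) ∧ (i : ℕ) < C.a + 2 * C.m

/-- Membership in `I`. [folklore] -/
theorem mem_I {i : Fin (2 * n)} : i ∈ C.I ↔ C.a ≤ (i : ℕ) ∧ (i : ℕ) < C.a + 2 * C.m := by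
  simp [I]

/-- The order embedding `[2m] ≅ I ⊆ [2n]`, `j ↦ a + j`. [folklore] -/
def up (j : Fin (2 * C.m)) : Fin (2 * n) :=
  ⟨C.a + j, by have := C.le; have := j.2; omega⟩

/-- Value of `up`. [folklore] -/
@[simp] theorem coe_up (j : Fin (2 * C.m)) : (C.up j : ℕ) = C.a + j := rfl

/-- `up` lands in `I`. [folklore] -/
theorem up_mem_I (j : Fin (2 * C.m)) : C.up j ∈ C.I := by
  rw [mem_I, coe_up]
  have := j.2
  omega

/-- `up` is strictly monotone (an order embedding). [folklore] -/
theorem up_lt_up {i j : Fin (2 * C.m)} : C.up i < C.up j ↔ i < j := by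
  rw [Fin.lt_def, Fin.lt_def, coe_up, coe_up]
  omega

/-- `up` is injective. [folklore] -/
theorem up_injective : Function.Injective C.up := fun i j h => by
  have h' := congrArg Fin.val h
  simp only [coe_up] at h'
  exact Fin.ext (by omega)

/-- The retraction `[2n] → [2m]` of `up`, `i ↦ i - a` on `I` (junk elsewhere). [folklore] -/
def dn (i : Fin (2 * n)) : Fin (2 * C.m) :=
  ⟨((i : ℕ) - C.a) % (2 * C.m), Nat.mod_lt _ (by have := C.pos; omega)⟩

/-- Value of `dn` on `I`. [folklore] -/
theorem coe_dn {i : Fin (2 * n)} (hi : i ∈ C.I) : (C.dn i : ℕ) = (i : ℕ) - C.a := by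
  rw [mem_I] at hi
  show ((i : ℕ) - C.a) % (2 * C.m) = _
  exact Nat.mod_eq_of_lt (by omega)

/-- `up ∘ dn = id` on `I`. [folklore] -/
theorem up_dn {i : Fin (2 * n)} (hi : i ∈ C.I) : C.up (C.dn i) = i := by
  apply Fin.ext
  rw [coe_up, C.coe_dn hi]
  rw [mem_I] at hi
  omega

/-- `dn ∘ up = id`. [folklore] -/
@[simp] theorem dn_up (j : Fin (2 * C.m)) : C.dn (C.up j) = j := by
  apply Fin.ext
  rw [C.coe_dn (C.up_mem_I j), coe_up]
  omega

/-- Outside `I`, the partner is outside `I` (both ends of `I` are even). [folklore] -/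
theorem partner_not_mem_I {i : Fin (2 * n)} (hi : i ∉ C.I) : partner i ∉ C.I := by
  rw [mem_I] at hi ⊢
  rw [partner_val]
  have := C.even
  split_ifs <;> omega

/-- `I` is an interval: a point between two points of `I` lies in `I`. [folklore] -/
theorem mem_I_of_between {i j l : Fin (2 * n)} (hi : i ∈ C.I) (hl : l ∈ C.I) (hij : i < j)
    (hjl : j < l) : j ∈ C.I := by
  rw [mem_I] at hi hl ⊢
  rw [Fin.lt_def] at hij hjl
  omega

/-! ### Restriction and extension of matchings -/

/-- Restriction of a matching `M` of `[2n]` to `I ≅ [2m]` (meaningful when `M` maps `I` into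
`I`). [folklore] -/
def restrict (M : Fin (2 * n) → Fin (2 * n)) : Fin (2 * C.m) → Fin (2 * C.m) := fun j =>
  C.dn (M (C.up j))

/-- Extension of a matching `N` of `[2m] ≅ I` to `[2n]` by consecutive pairs outside `I`.
[folklore] -/
def extend (N : Fin (2 * C.m) → Fin (2 * C.m)) : Fin (2 * n) → Fin (2 * n) := fun i =>
  if i ∈ C.I then C.up (N (C.dn i)) else partner i

/-- `extend` on `I`. [folklore] -/
theorem extend_apply_of_mem (N : Fin (2 * C.m) → Fin (2 * C.m)) {i : Fin (2 * n)}
    (hi : i ∈ C.I) : C.extend N i = C.up (N (C.dn i)) :=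
  if_pos hi

/-- `extend` outside `I`. [folklore] -/
theorem extend_apply_of_not_mem (N : Fin (2 * C.m) → Fin (2 * C.m)) {i : Fin (2 * n)}
    (hi : i ∉ C.I) : C.extend N i = partner i :=
  if_neg hi

/-- `extend N (a + j) = a + N j`. [folklore] -/
theorem extend_up (N : Fin (2 * C.m) → Fin (2 * C.m)) (j : Fin (2 * C.m)) :
    C.extend N (C.up j) = C.up (N j) := by
  rw [C.extend_apply_of_mem N (C.up_mem_I j), dn_up]

/-- `extend N` never crosses the boundary of `I`. [folklore] -/
theorem extend_mem_I_iff (N : Fin (2 * C.m) → Fin (2 * C.m)) (i : Fin (2 * n)) :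
    C.extend N i ∈ C.I ↔ i ∈ C.I := by
  by_cases hi : i ∈ C.I
  · rw [C.extend_apply_of_mem N hi]
    exact iff_of_true (C.up_mem_I _) hi
  · rw [C.extend_apply_of_not_mem N hi]
    exact iff_of_false (C.partner_not_mem_I hi) hi

/-- `restrict ∘ extend = id`. [folklore] -/
theorem restrict_extend (N : Fin (2 * C.m) → Fin (2 * C.m)) : C.restrict (C.extend N) = N := by
  funext j
  show C.dn (C.extend N (C.up j)) = N j
  rw [extend_up, dn_up]

/-- If `M` maps `I` into `I`, `up ∘ restrict M = M ∘ up`. [folklore] -/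
theorem up_restrict {M : Fin (2 * n) → Fin (2 * n)} (hI : ∀ j, M (C.up j) ∈ C.I)
    (j : Fin (2 * C.m)) : C.up (C.restrict M j) = M (C.up j) :=
  C.up_dn (hI j)

/-- If `M` maps `I` into `I`, the openers of `restrict M` are the internal openers of `M`.
[folklore] -/
theorem lt_restrict_iff {M : Fin (2 * n) → Fin (2 * n)} (hI : ∀ j, M (C.up j) ∈ C.I)
    (j : Fin (2 * C.m)) : j < C.restrict M j ↔ C.up j < M (C.up j) := by
  rw [← C.up_lt_up, C.up_restrict hI]

/-- **Restriction.** A nest-free perfect matching of `[2n]` mapping `I` into `I` restricts to a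
nest-free perfect matching of `I ≅ [2m]`. [folklore] -/
theorem restrict_mem_nestFreeMatchings {M : Fin (2 * n) → Fin (2 * n)}
    (hM : M ∈ nestFreeMatchings (2 * n)) (hI : ∀ j, M (C.up j) ∈ C.I) :
    C.restrict M ∈ nestFreeMatchings (2 * C.m) := by
  obtain ⟨hperf, hnest⟩ := mem_nestFreeMatchings.1 hM
  obtain ⟨hinv, hfp⟩ := mem_perfectMatchings.1 hperf
  refine mem_nestFreeMatchings.2 ⟨mem_perfectMatchings.2 ⟨fun j => ?_, fun j h => ?_⟩, ?_⟩
  · apply C.up_injective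
    rw [C.up_restrict hI, C.up_restrict hI, hinv]
  · have h' := congrArg C.up h
    rw [C.up_restrict hI] at h'
    exact hfp _ h'
  · intro i j hij hj hji
    refine hnest (C.up i) (C.up j) (C.up_lt_up.2 hij) ?_ ?_
    · rw [← C.up_restrict hI]; exact C.up_lt_up.2 hj
    · rw [← C.up_restrict hI, ← C.up_restrict hI]; exact C.up_lt_up.2 hji

/-- **Extension.** A nest-free perfect matching of `[2m] ≅ I` extends by consecutive pairs
outside `I` to a nest-free perfect matching of `[2n]`. [folklore] -/
theorem extend_mem_nestFreeMatchings {N : Fin (2 * C.m) → Fin (2 * C.m)}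
    (hN : N ∈ nestFreeMatchings (2 * C.m)) : C.extend N ∈ nestFreeMatchings (2 * n) := by
  obtain ⟨hperf, hnest⟩ := mem_nestFreeMatchings.1 hN
  obtain ⟨hinv, hfp⟩ := mem_perfectMatchings.1 hperf
  refine mem_nestFreeMatchings.2 ⟨mem_perfectMatchings.2 ⟨fun i => ?_, fun i h => ?_⟩, ?_⟩
  · by_cases hi : i ∈ C.I
    · rw [C.extend_apply_of_mem N hi, extend_up, hinv, C.up_dn hi]
    · rw [C.extend_apply_of_not_mem N hi, C.extend_apply_of_not_mem N (C.partner_not_mem_I hi),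
        partner_partner]
  · by_cases hi : i ∈ C.I
    · rw [C.extend_apply_of_mem N hi] at h
      have h' : C.up (N (C.dn i)) = C.up (C.dn i) := by rw [h, C.up_dn hi]
      exact hfp _ (C.up_injective h')
    · rw [C.extend_apply_of_not_mem N hi] at h
      exact partner_ne i h
  · intro i j hij hj hji
    by_cases hi : i ∈ C.I
    · have hEi : C.extend N i ∈ C.I := (C.extend_mem_I_iff N i).2 hi
      have hjI : j ∈ C.I := C.mem_I_of_between hi hEi hij (hj.trans hji)
      rw [C.extend_apply_of_mem N hi] at hji
      rw [C.extend_apply_of_mem N hjI] at hj hji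
      refine hnest (C.dn i) (C.dn j) ?_ ?_ ?_
      · rw [← C.up_lt_up, C.up_dn hi, C.up_dn hjI]; exact hij
      · rw [← C.up_lt_up, C.up_dn hjI]; exact hj
      · rw [← C.up_lt_up]; exact hji
    · rw [C.extend_apply_of_not_mem N hi] at hji
      have h1 := hij.trans (hj.trans hji)
      rw [Fin.lt_def, partner_val] at h1
      rw [Fin.lt_def] at hij hj hji
      rw [partner_val] at hji
      split_ifs at h1 hji <;> omega

/-! ### Internal arcs -/

/-- The internal openers of `M` (arcs of `M` with both endpoints in `I`), in the coordinates of
`[2m]`. [folklore] -/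
def intOp (M : Fin (2 * n) → Fin (2 * n)) : Finset (Fin (2 * C.m)) :=
  univ.filter fun j => C.up j < M (C.up j) ∧ M (C.up j) ∈ C.I

/-- The internal closers of `M`, in the coordinates of `[2m]`. [folklore] -/
def intCl (M : Fin (2 * n) → Fin (2 * n)) : Finset (Fin (2 * C.m)) :=
  univ.filter fun j => M (C.up j) < C.up j ∧ M (C.up j) ∈ C.I

/-- Membership in `intOp`. [folklore] -/
theorem mem_intOp {M : Fin (2 * n) → Fin (2 * n)} {j : Fin (2 * C.m)} :
    j ∈ C.intOp M ↔ C.up j < M (C.up j) ∧ M (C.up j) ∈ C.I := by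
  simp [intOp]

/-- Membership in `intCl`. [folklore] -/
theorem mem_intCl {M : Fin (2 * n) → Fin (2 * n)} {j : Fin (2 * C.m)} :
    j ∈ C.intCl M ↔ M (C.up j) < C.up j ∧ M (C.up j) ∈ C.I := by
  simp [intCl]

/-- In a perfect matching there are at most as many internal openers as internal closers
(`j ↦ M j` injects the former into the latter). [folklore] -/
theorem card_intOp_le_card_intCl {M : Fin (2 * n) → Fin (2 * n)}
    (hM : M ∈ perfectMatchings (2 * n)) : (C.intOp M).card ≤ (C.intCl M).card := by
  obtain ⟨hinv, -⟩ := mem_perfectMatchings.1 hM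
  refine Finset.card_le_card_of_injOn (fun j => C.dn (M (C.up j))) (fun j hj => ?_)
    (fun j₁ hj₁ j₂ hj₂ h => ?_)
  · rw [mem_coe, mem_intOp] at hj
    rw [mem_coe, mem_intCl, C.up_dn hj.2, hinv]
    exact ⟨hj.1, C.up_mem_I j⟩
  · rw [mem_coe, mem_intOp] at hj₁ hj₂
    have h' := congrArg C.up h
    simp only [C.up_dn hj₁.2, C.up_dn hj₂.2] at h'
    exact C.up_injective (Function.Involutive.injective hinv h')

/-- Internal openers and closers are disjoint. [folklore] -/
theorem disjoint_intOp_intCl (M : Fin (2 * n) → Fin (2 * n)) :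
    Disjoint (C.intOp M) (C.intCl M) := by
  rw [Finset.disjoint_left]
  intro j h1 h2
  rw [mem_intOp] at h1
  rw [mem_intCl] at h2
  exact lt_asymm h1.1 h2.1

/-- **At most `m` internal arcs.** [folklore] -/
theorem card_intOp_le {M : Fin (2 * n) → Fin (2 * n)} (hM : M ∈ perfectMatchings (2 * n)) :
    (C.intOp M).card ≤ C.m := by
  have h1 := C.card_intOp_le_card_intCl hM
  have h2 : (C.intOp M ∪ C.intCl M).card ≤ 2 * C.m := by
    calc (C.intOp M ∪ C.intCl M).card ≤ Fintype.card (Fin (2 * C.m)) := card_le_univ _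
      _ = 2 * C.m := Fintype.card_fin _
  rw [card_union_of_disjoint (C.disjoint_intOp_intCl M)] at h2
  omega

/-- **Exactly `m` internal arcs only if `I` is matched into itself.** [folklore] -/
theorem forall_mem_I_of_card_intOp {M : Fin (2 * n) → Fin (2 * n)}
    (hM : M ∈ perfectMatchings (2 * n)) (h : (C.intOp M).card = C.m) :
    ∀ j, M (C.up j) ∈ C.I := by
  have h1 := C.card_intOp_le_card_intCl hM
  have h3 : (C.intOp M ∪ C.intCl M).card ≤ 2 * C.m := by
    calc (C.intOp M ∪ C.intCl M).card ≤ Fintype.card (Fin (2 * C.m)) := card_le_univ _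
      _ = 2 * C.m := Fintype.card_fin _
  have hU : C.intOp M ∪ C.intCl M = univ := by
    apply Finset.eq_univ_of_card
    rw [Fintype.card_fin, card_union_of_disjoint (C.disjoint_intOp_intCl M)]
    rw [card_union_of_disjoint (C.disjoint_intOp_intCl M)] at h3
    omega
  intro j
  have hj : j ∈ C.intOp M ∪ C.intCl M := hU ▸ mem_univ j
  rcases mem_union.1 hj with h' | h'
  · exact (C.mem_intOp.1 h').2
  · exact (C.mem_intCl.1 h').2

end Carving

end Summit.ValiantsHypothesis.ValiantsHypothesis.Theorems.FifoMatching.NNLowDegreeCofactorHard.FreedVertices.Carve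

end
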